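import Mathlib
import HarnessLib
import Summits.AtomisticToContinuum.Statement

/-!
# Crux `MacroClosure` (stmt-AtomisticToContinuum-14870) — ideator 2 (round 1, gen 1): first lemmas

Sketch file of `planner-cruxidea-stmt-AtomisticToContinuum-14870-2-0` for the crux idea card
`barycentric-bregman-invariant-clausius`.  Everything is stated over tree declarations: the route
file `CollisionIsometryCLT` (rev 13: `AprioriBoundsPreShock`, `FastMomentRelaxationPreShock`), the
route `ImplosionDichotomy` (`HydroLimitInBand`, `DiluteSelfConsistency`, `closes`) and the lead's
importable vocabulary `Theorems/CollisionIsometryCLTMacroClosureDefs.lean`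
(`MacroClosureLine.{State, Flow, hsEntropy, relEnt, stateOf, bU, AdmissibleKernel, EngineLocal}`).

Contents
* `MacroClosureInBand`, `macroClosure_of_inBand`, `macroClosure_of_engineLocal` — the in-band docking
  re-typed on the rev-12/13 PRE-SHOCK hypotheses (the crux-dir `IdeatorTwoSketch.lean` still names the
  retired `AprioriBounds` / `FastMomentRelaxation`); PROVED, pure logic.
* `jensen_dirac` — the Jensen–Dirac squeeze (equality case of Jensen for a strictly convex entropy):
  a probability law on states whose mean entropy does not exceed the entropy of its barycentre is the
  Dirac mass at the barycentre.  PROVED from Mathlib's strict Jensen inequality.  It is the `t = 0`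
  identification and the final readout of the line in their limiting (defect-free) form.
* `torus_jensen_floor` — the sure lower bound `η(∫ₓ Ū) ≤ ∫ₓ η(Ū)` on the flat torus (conditioning on the
  good event costs only `P(Gᶜ)·O(1)` because the block entropy functional is bounded below by a
  function of the conserved totals).  PROVED.
* `ClausiusInMean` — the ONE particle-level input of the line beyond the crux's three hypotheses: the
  expected hard-sphere block entropy functional `E ∫ₓ η_σ(Ū_N(t,x)) dx` never exceeds its classical
  initial value `∫ₓ η_σ(U_cl(0,x)) dx` asymptotically, UNIFORMLY in `t` (Liouville invariance of the
  homogeneous canonical law + homogeneous block large deviations with a sub-unit tilt + the `t = 0`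
  entropy value).  Typed `Prop`, not proved here.
* `HomogeneousSubunitBlockLD` — the single static object the Clausius stub consumes: Varadhan's upper
  bound for the block Bregman functional under the HOMOGENEOUS (flow-invariant) canonical law with any
  tilt `< 1` (finite because cold blocks cost `θ̄^{(3n/2)(1−γ)}`).  Typed `Prop`.
-/

noncomputable section

open MeasureTheory Filter Set Topology
open scoped ENNReal

namespace Summit.AtomisticToContinuum.HydrodynamicLimit.Cruxes.MacroClosure.BarycentricBregmanStandalone

open Literature.MathematicalPhysics.KineticTheory Literature.Analysis.FluidPDE
open Literature.Analysis.FunctionSpaces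


/-! ## 0. Vocabulary — VERBATIM copies of the lead's `Theorems/CollisionIsometryCLTMacroClosureDefs.lean`
(`MacroClosureLine.{State, Flow, hsEntropy, relEnt, stateOf, AdmissibleKernel, bρ, bm, bE, bU, EngineLocal}`;
this self-contained variant exists only because the farm snapshot had not yet built that module when the
sketch was checked — the line imports the lead's file and these copies disappear). -/

/-- Conserved state `U = (ρ, m, E)` (verbatim `MacroClosureLine.State`). -/
abbrev State : Type := ℝ × V3 × ℝ

/-- Hard-sphere flows of `N + 1` spheres at reduced diameter `σ` (verbatim `MacroClosureLine.Flow`). -/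
abbrev Flow (σ : ℝ) (N : ℕ) : Type :=
  HardSphereFlow (Torus.geometry (Fin 3)) (hsDiameter σ N) (N + 1)

/-- The convex hard-sphere entropy `η_σ(U)` (verbatim `MacroClosureLine.hsEntropy` = the `ησ` of
stmt-9520/9521/9525/9526). -/
def hsEntropy (σ : ℝ) (U : State) : ℝ :=
  -(U.1 * (3 / 2 * Real.log (2 / 3 * (U.2.2 / U.1 - ‖U.2.1‖ ^ 2 / (2 * U.1 ^ 2))) - Real.log U.1 -
    hsExcessFreeEnergy (U.1 * σ ^ 3)))

/-- Relative entropy density `h_σ(V | U)` (verbatim `MacroClosureLine.relEnt`). -/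
def relEnt (σ : ℝ) (V U : State) : ℝ :=
  hsEntropy σ V - hsEntropy σ U - fderiv ℝ (hsEntropy σ) U (V - U)

/-- Conserved state of the primitive variables (verbatim `MacroClosureLine.stateOf`). -/
def stateOf (ρ : ℝ) (u : V3) (θ : ℝ) : State := (ρ, ρ • u, totalEnergyDensity ρ u θ)

/-- Admissible kernel family (verbatim `MacroClosureLine.AdmissibleKernel`). -/
def AdmissibleKernel (γ C : ℝ) (φ : ℕ → T3 → ℝ) : Prop :=
  (∀ N, Torus.IsSmooth (φ N)) ∧ (∀ N y, 0 ≤ φ N y) ∧ (∀ N, ∫ y, φ N y = 1) ∧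
  (∀ (N : ℕ) y, ((N : ℝ) + 1) ^ (-γ) ≤ Torus.euclidDist y 0 → φ N y = 0) ∧
  (∀ (N : ℕ) y, φ N y ≤ C * ((N : ℝ) + 1) ^ (3 * γ)) ∧
  (∀ (N : ℕ) y, ‖Torus.gradient (φ N) y‖ ≤ C * ((N : ℝ) + 1) ^ (4 * γ))

section Blocks

variable {n : ℕ}

/-- Block density (verbatim `MacroClosureLine.bρ`). -/
def bρ (φ : T3 → ℝ) (z : Config n (Fin 3) T3) (x : T3) : ℝ :=
  empiricalDensityField z (fun y => φ (y - x))

/-- Block momentum (verbatim `MacroClosureLine.bm`). -/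
def bm (φ : T3 → ℝ) (z : Config n (Fin 3) T3) (x : T3) : V3 :=
  empiricalMomentumField z (fun y => φ (y - x))

/-- Block energy (verbatim `MacroClosureLine.bE`). -/
def bE (φ : T3 → ℝ) (z : Config n (Fin 3) T3) (x : T3) : ℝ :=
  empiricalEnergyField z (fun y => φ (y - x))

/-- Block conserved state (verbatim `MacroClosureLine.bU`). -/
def bU (φ : T3 → ℝ) (z : Config n (Fin 3) T3) (x : T3) : State := (bρ φ z x, bm φ z x, bE φ z x)

end Blocks

/-- The LOCAL IN-BAND ENGINE (verbatim `MacroClosureLine.EngineLocal`). -/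
def EngineLocal : Prop :=
  ∀ (a₀ θ₀ : T3 → ℝ) (u₀ : T3 → V3), Continuous a₀ → Continuous θ₀ → Continuous u₀ →
    (∀ x, 0 < a₀ x) → (∀ x, 0 < θ₀ x) →
    ∃ σ₀ : ℝ, 0 < σ₀ ∧ ∃ η : ℝ, 0 < η ∧ ∀ σ : ℝ, 0 < σ → σ < σ₀ →
      ∀ (T : ℝ) (ρ θ : ℝ → T3 → ℝ) (u : ℝ → T3 → V3), IsHardSphereEulerSolution σ T ρ u θ →
        ∀ Φ : (N : ℕ) → Flow σ N,
          TendstoHydroFieldsAt (fun N => localGibbsLaw σ a₀ u₀ θ₀ N (Φ N)) Φ ρ u θ 0 →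
            (∀ t ∈ Ico 0 T, ∀ x, ρ t x * σ ^ 3 < η) →
            ∀ t ∈ Ico 0 T, TendstoHydroFieldsAt (fun N => localGibbsLaw σ a₀ u₀ θ₀ N (Φ N)) Φ ρ u θ t


/-! ## 0b. VERBATIM copies of `ImplosionDichotomy.{DiluteSelfConsistency, HydroLimitInBand, closes}` (stmt-3091 /
stmt-9133 / the route's deciding theorem) — this STANDALONE variant imports no route file at all (only the summit
Statement, unchanged since 2026-08-14), because the farm snapshot was incoherent with every route file touched by the
gate this hour.  The full sketch (importing `CollisionIsometryCLT` + `ImplosionDichotomy`, rc 0 against the snapshot)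
is attached as evidence `IdeatorTwoGen1Sketch.lean` on the item. -/

namespace ImplosionDichotomyCopy

/-- verbatim `ImplosionDichotomyCopy.DiluteSelfConsistency` (stmt-AtomisticToContinuum-3091). -/
def DiluteSelfConsistency : Prop :=
  ∀ η : ℝ, 0 < η → ∀ (a₀ θ₀ : Literature.MathematicalPhysics.KineticTheory.T3 → ℝ) (u₀ : Literature.MathematicalPhysics.KineticTheory.T3 → Literature.MathematicalPhysics.KineticTheory.V3), Continuous a₀ → Continuous θ₀ → Continuous u₀ → (∀ x, 0 < a₀ x) → (∀ x, 0 < θ₀ x) → ∃ σ₀ : ℝ, 0 < σ₀ ∧ ∀ σ : ℝ, 0 < σ → σ < σ₀ → ∀ (T : ℝ) (ρ θ : ℝ → Literature.MathematicalPhysics.KineticTheory.T3 → ℝ) (u : ℝ → Literature.MathematicalPhysics.KineticTheory.T3 → Literature.MathematicalPhysics.KineticTheory.V3), Literature.MathematicalPhysics.KineticTheory.IsHardSphereEulerSolution σ T ρ u θ → ∀ Φ : (N : ℕ) → Literature.Analysis.FluidPDE.HardSphereFlow (Literature.Analysis.FluidPDE.Torus.geometry (Fin 3)) (Literature.MathematicalPhysics.KineticTheory.hsDiameter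 σ N) (N + 1), Literature.MathematicalPhysics.KineticTheory.TendstoHydroFieldsAt (fun N => Literature.MathematicalPhysics.KineticTheory.localGibbsLaw σ a₀ u₀ θ₀ N (Φ N)) Φ ρ u θ 0 → ∀ t ∈ Set.Ico 0 T, ∀ x, ρ t x * σ ^ 3 < η

/-- verbatim `ImplosionDichotomyCopy.HydroLimitInBand` (stmt-AtomisticToContinuum-9133). -/
def HydroLimitInBand : Prop :=
  ∃ η₀ : ℝ, 0 < η₀ ∧ ∀ (a₀ θ₀ : Literature.MathematicalPhysics.KineticTheory.T3 → ℝ) (u₀ : Literature.MathematicalPhysics.KineticTheory.T3 → Literature.MathematicalPhysics.KineticTheory.V3), Continuous a₀ → Continuous θ₀ → Continuous u₀ → (∀ x, 0 < a₀ x) → (∀ x, 0 < θ₀ x) → ∃ σ₀ : ℝ, 0 < σ₀ ∧ ∀ σ : ℝ, 0 < σ → σ < σ₀ → ∀ (T : ℝ) (ρ θ : ℝ → Literature.MathematicalPhysics.KineticTheory.T3 → ℝ) (u : ℝ → Literature.MathematicalPhysics.KineticTheory.T3 → Literature.MathematicalPhysics.KineticTheory.V3), Literature.MathematicalPhysics.KineticTheory.IsHardSphereEulerSolution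 σ T ρ u θ → (∀ t ∈ Set.Ico 0 T, ∀ x, ρ t x * σ ^ 3 < η₀) → ∀ Φ : (N : ℕ) → Literature.Analysis.FluidPDE.HardSphereFlow (Literature.Analysis.FluidPDE.Torus.geometry (Fin 3)) (Literature.MathematicalPhysics.KineticTheory.hsDiameter σ N) (N + 1), Literature.MathematicalPhysics.KineticTheory.TendstoHydroFieldsAt (fun N => Literature.MathematicalPhysics.KineticTheory.localGibbsLaw σ a₀ u₀ θ₀ N (Φ N)) Φ ρ u θ 0 → ∀ t ∈ Set.Ico 0 T, Literature.MathematicalPhysics.KineticTheory.TendstoHydroFieldsAt (fun N => Literature.MathematicalPhysics.KineticTheory.localGibbsLaw σ a₀ u₀ θ₀ N (Φ N)) Φ ρ u θ t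

/-- verbatim `ImplosionDichotomyCopy.closes` (pure quantifier bookkeeping). -/
theorem closes (hD : DiluteSelfConsistency) (hB : HydroLimitInBand) : _root_.HydrodynamicLimit := by
  obtain ⟨η₀, hη₀, H⟩ := hB
  intro a₀ θ₀ u₀ ha hθ hu ha0 hθ0
  obtain ⟨σ₁, hσ₁, G⟩ := H a₀ θ₀ u₀ ha hθ hu ha0 hθ0
  obtain ⟨σ₂, hσ₂, D⟩ := hD η₀ hη₀ a₀ θ₀ u₀ ha hθ hu ha0 hθ0
  refine ⟨min σ₁ σ₂, lt_min hσ₁ hσ₂, ?_⟩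
  intro σ hσ hσlt T ρ θ u hE Φ h0 t ht
  exact G σ hσ (lt_of_lt_of_le hσlt (min_le_left _ _)) T ρ θ u hE
    (fun s hs x => D σ hσ (lt_of_lt_of_le hσlt (min_le_right _ _)) T ρ θ u hE Φ h0 s hs x) Φ h0 t ht

end ImplosionDichotomyCopy

/-! ## 1. In-band docking (pure logic, proved) — ABSTRACT form

This CORE variant does not import the route file `CollisionIsometryCLT` (the farm snapshot was incoherent with the
hub's copy of that module when the file was published); the three closure hypotheses are therefore abstract `Prop`s.
Instantiating `CTL APS FMR` with `CollisionIsometryCLT.{CollisionalTransferLocality, AprioriBoundsPreShock,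
FastMomentRelaxationPreShock}` turns the conclusions below into `CollisionIsometryCLT.MacroClosure` BY `Iff.rfl`
(see the full sketch `IdeatorTwoGen1Sketch.lean` attached as evidence on the item, rc 0 against the snapshot). -/

/-- TRANSFER (pure logic, abstract): an in-band engine `CTL → APS → FMR → HydroLimitInBand` plus dilute
self-consistency gives `CTL → APS → FMR → HydrodynamicLimit` (= the crux once instantiated). -/
theorem macroClosure_of_inBand_abstract {CTL APS FMR : Prop}
    (hD : ImplosionDichotomyCopy.DiluteSelfConsistency)
    (hB : CTL → APS → FMR → ImplosionDichotomyCopy.HydroLimitInBand) :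
    CTL → APS → FMR → _root_.HydrodynamicLimit :=
  fun h₂ h₃ hF => ImplosionDichotomyCopy.closes hD (hB h₂ h₃ hF)

/-- TRANSFER (pure logic, abstract) at the PROFILE-WISE chamber level `EngineLocal` (`∃ η` after the profiles). -/
theorem macroClosure_of_engineLocal_abstract {CTL APS FMR : Prop}
    (hD : ImplosionDichotomyCopy.DiluteSelfConsistency) (hE : CTL → APS → FMR → EngineLocal) :
    CTL → APS → FMR → _root_.HydrodynamicLimit := by
  intro h₂ h₃ hF a₀ θ₀ u₀ ha hθ hu ha0 hθ0
  obtain ⟨σ₁, hσ₁, η, hη, G⟩ := hE h₂ h₃ hF a₀ θ₀ u₀ ha hθ hu ha0 hθ0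
  obtain ⟨σ₂, hσ₂, D⟩ := hD η hη a₀ θ₀ u₀ ha hθ hu ha0 hθ0
  refine ⟨min σ₁ σ₂, lt_min hσ₁ hσ₂, ?_⟩
  intro σ hσ hσlt T ρ θ u hsol Φ h0 t ht
  exact G σ hσ (lt_of_lt_of_le hσlt (min_le_left _ _)) T ρ θ u hsol Φ h0
    (fun s hs x => D σ hσ (lt_of_lt_of_le hσlt (min_le_right _ _)) T ρ θ u hsol Φ h0 s hs x) t ht

/-! ## 2. The Jensen–Dirac squeeze (proved) -/

/-- **Jensen–Dirac squeeze.**  Let `ν` be a probability law on a Banach space `E` (e.g. the state space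
`State = ℝ × V3 × ℝ`), supported in a closed convex set `s` on which `g` is continuous and strictly
convex.  If the mean of `g` does not exceed `g` at the barycentre, `∫ g dν ≤ g(∫ x dν)`, then `ν`-a.e.
point IS the barycentre (so `ν` is the Dirac mass there).  In the line this is (i) the identification
of the time-`0` one-point law from the MACROSCOPIC law of large numbers plus the Clausius inequality
at `t = 0`, and (ii) the readout `H_N(t) → 0 ⇒ ν_t = δ_{U_cl(t)}` in its limiting form. -/
theorem jensen_dirac {E : Type*} [NormedAddCommGroup E] [NormedSpace ℝ E] [CompleteSpace E]
    [MeasurableSpace E] [BorelSpace E] [SecondCountableTopology E]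
    {ν : Measure E} [IsProbabilityMeasure ν] {s : Set E} {g : E → ℝ}
    (hg : StrictConvexOn ℝ s g) (hgc : ContinuousOn g s) (hsc : IsClosed s)
    (hνs : ∀ᵐ x ∂ν, x ∈ s) (hint : Integrable (fun x : E => x) ν) (hgi : Integrable g ν)
    (hsq : ∫ x, g x ∂ν ≤ g (∫ x, x ∂ν)) :
    ∀ᵐ x ∂ν, x = ∫ y, y ∂ν := by
  have hgi' : Integrable (g ∘ fun x : E => x) ν := hgi
  have h := hg.ae_eq_const_or_map_average_lt hgc hsc hνs hint hgi'
  rcases h with h | h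
  · filter_upwards [h] with x hx
    simpa [average_eq_integral] using hx
  · exfalso
    have h' : g (∫ x, x ∂ν) < ∫ x, g x ∂ν := by simpa [average_eq_integral] using h
    exact absurd hsq (not_le.mpr h')

/-! ## 3. The sure floor of the block entropy functional on the torus (proved) -/

/-- **Torus Jensen floor.**  For a convex continuous `η` on a closed convex set `s` of states and an
integrable block-field configuration `U : 𝕋³ → State` with values in `s`,
`η(∫ₓ U) ≤ ∫ₓ η(U)`: the block entropy functional is bounded below by `η` of the conserved totals
(mass, momentum, energy), SURELY.  Used to pay the bad event `Gᶜ` inside conditional means without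
any rate. -/
theorem torus_jensen_floor {E : Type*} [NormedAddCommGroup E] [NormedSpace ℝ E] [CompleteSpace E]
    {s : Set E} {η : E → ℝ} (hη : ConvexOn ℝ s η) (hηc : ContinuousOn η s) (hsc : IsClosed s)
    (U : T3 → E) (hUs : ∀ᵐ x ∂(volume : Measure T3), U x ∈ s) (hUi : Integrable U)
    (hηU : Integrable (η ∘ U)) :
    η (∫ x, U x) ≤ ∫ x, η (U x) := by
  haveI : IsProbabilityMeasure (volume : Measure T3) := inferInstance
  have h := hη.map_average_le hηc hsc hUs hUi hηU
  simpa [average_eq_integral] using h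

/-! ## 4. The admissibility input of the line: Clausius in mean, uniformly in time (typed) -/

/-- **Homogeneous sub-unit block large deviations** (the ONE static object of the line; Varadhan's
upper bound under the flow-INVARIANT homogeneous canonical law `localGibbsLaw σ 1 u_c θ_c`, never
under a steered reference): for every tilt `γ < 1`, every admissible kernel family and every
`ε > 0`, eventually in `N`,
`E_G exp(γ (N+1) ∫ₓ h_σ(Ū_N(z,x) | U_c) dx) ≤ e^{ε (N+1)}`, `U_c = stateOf 1 u_c θ_c` the homogeneous
state.  (Finite exactly because `γ < 1`: a cold block of `n` spheres costs `θ̄^{(3n/2)(1−γ)}`; dense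
blocks are priced by the free-volume ceiling at packing `≤ σ³·sup φ`, dilute for `σ < σ₀`.) -/
def HomogeneousSubunitBlockLD : Prop :=
  ∃ σ₀ : ℝ, 0 < σ₀ ∧ ∀ σ : ℝ, 0 < σ → σ < σ₀ → ∀ (uc : V3) (θc : ℝ), 0 < θc →
    ∀ (γt C : ℝ) (φ : ℕ → T3 → ℝ), 0 < γt → γt ≤ 1 / 15 → AdmissibleKernel γt C φ →
    ∀ γ : ℝ, 0 < γ → γ < 1 → ∀ ε : ℝ, 0 < ε → ∀ᶠ N : ℕ in atTop, ∀ Φ : Flow σ N,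
      ∫ z, Real.exp (γ * ((N : ℝ) + 1) *
          ∫ x, relEnt σ (bU (φ N) z x) (stateOf 1 uc θc)) ∂(localGibbsLaw σ (fun _ => 1)
            (fun _ => uc) (fun _ => θc) N Φ) ≤ Real.exp (ε * ((N : ℝ) + 1))

/-- **Clausius in mean, uniformly in time** (stub `stub_clausius` of the line; the fixed-time,
in-expectation weakening of `StiffCollisionalRelaxation.SecondLawInProbability`, stmt-9521, with NO
`sup` over `τ` inside a probability and no chamber proviso): for all profiles `∃ σ₀` such that for
`σ < σ₀`, every classical hs-Euler solution on `[0,T)` whose `t = 0` fields are the LLN limit of the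
local Gibbs laws, every flow family and every admissible kernel family, for every `t₁ < T` and
`δ > 0`, eventually in `N`, for ALL `t ∈ [0, t₁]`,
`E_{localGibbsLaw} ∫ₓ η_σ(Ū_N(Φ_t z, x)) dx ≤ ∫ₓ η_σ(U_cl(0,x)) dx + δ`.
Intended proof: `H(P_t | G) = H(P_0 | G)` for the homogeneous invariant law `G`
(`GibbsInvariance`, stmt-9239) + the entropy inequality with the tilt `γ(N+1)∫ h_σ(Ū | U_c)`,
`γ ↑ 1` (`HomogeneousSubunitBlockLD`) + exact conservation `∫ₓ(Ū_t − U_c) = const` + the initial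
VALUE `H(P_0 | G)/(N+1) → ∫ h_σ(U_cl(0) | U_c)` (t = 0 dilute statics, the activity–density relation
being the Euler–Lagrange equation of the homogeneous rate function). -/
def ClausiusInMean : Prop :=
  ∀ (a₀ θ₀ : T3 → ℝ) (u₀ : T3 → V3), Continuous a₀ → Continuous θ₀ → Continuous u₀ →
    (∀ x, 0 < a₀ x) → (∀ x, 0 < θ₀ x) →
    ∃ σ₀ : ℝ, 0 < σ₀ ∧ ∀ σ : ℝ, 0 < σ → σ < σ₀ →
      ∀ (T : ℝ) (ρ θ : ℝ → T3 → ℝ) (u : ℝ → T3 → V3), IsHardSphereEulerSolution σ T ρ u θ →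
        ∀ Φ : (N : ℕ) → Flow σ N,
          TendstoHydroFieldsAt (fun N => localGibbsLaw σ a₀ u₀ θ₀ N (Φ N)) Φ ρ u θ 0 →
          ∀ (γ C : ℝ) (φ : ℕ → T3 → ℝ), 0 < γ → γ ≤ 1 / 15 → AdmissibleKernel γ C φ →
          ∀ t₁ : ℝ, 0 < t₁ → t₁ < T → ∀ δ : ℝ, 0 < δ → ∀ᶠ N : ℕ in atTop, ∀ t ∈ Icc 0 t₁,
            (∫ z, (∫ x, hsEntropy σ (bU (φ N) ((Φ N).flow t z) x))
                ∂(localGibbsLaw σ a₀ u₀ θ₀ N (Φ N))) ≤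
              (∫ x, hsEntropy σ (stateOf (ρ 0 x) (u 0 x) (θ 0 x))) + δ

end Summit.AtomisticToContinuum.HydrodynamicLimit.Cruxes.MacroClosure.BarycentricBregmanStandalone

end
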